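import Summits.SmoothPoincare4.SmoothPoincare4.Theorems.EntropyRungNoncompactShrinkerGapHeatVeryWeakNoncompact
import Summits.SmoothPoincare4.SmoothPoincare4.Theorems.EntropyRungNoncompactShrinkerGapHeatHypoellipticNoncompact
import Summits.SmoothPoincare4.SmoothPoincare4.Theorems.EntropyRungNoncompactShrinkerGapHeatClassicalNoncompact
import Summits.SmoothPoincare4.SmoothPoincare4.Theorems.EntropyRungNoncompactShrinkerGapHeatEnergyVanishing
import Literature.Geometry.Riemannian.LinearHeatForcedExistence
import Literature.Geometry.Lorentzian.HessianLinear
import HarnessLib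

/-!
# The linear heat Cauchy problem with compactly supported datum on a complete manifold: smooth solutions
# up to `s = 0` in `L²` of the strip (crux `EntropyRung.NoncompactShrinkerGap`, stmt-SmoothPoincare4-10868,
# line `collapsed-ends-usc`, skeleton v13)

Registered helper `helper_linearHeat_noncompact` of the stub `stub_compactSupportLSI`: the non-compact,
static-metric version of `exists_smooth_linearHeat_forcing` + `exists_smooth_linearHeat_cauchy_of_coercive`
(`LinearHeatForcedExistence.lean`, `LinearHeatCauchyExistence.lean`, closed manifolds). Setting: `(M, g)`
Riemannian, modelled on `ℝⁿ` (Hausdorff, second countable, `T₃` — NOT compact), Laplacian cut-offs `η_k`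
(`|Δη_k| ≤ C`, eventually `1` near every point), a potential `Q ≥ 1` smooth on `M × ℝ`, and flat-corrector data
`(W, G, K)` (`W`, `G` smooth on `M × ℝ`, vanishing off the compact `K` and for `s ≥ 1`, `G = 0` for `s ≤ 0`,
`G = −(∂ₛW − ΔW + QW)` for `s ≥ 0`). CONCLUSION: for every `T > 0` a function `w`, smooth on
`M × (−∞, T + 1)`, with `w(0) = W(0)`, `∂ₛw = Δw − Qw` on `[0, T]`, and `w ∈ L²(M × (0, T))`.

Proof (Trèves 1975, §41, as in the tree with compactness replaced by the landed non-compact helpers):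
Lions' very weak solution `u ∈ L²` of `∂u = Δu − Qu + G` on `M × (−2, T+1)` with zero data, extended by
zero (`helper_veryWeakHeat_noncompact`; `G` has compact support in `K × [0, 1]`); it is very weak on
`M × (−∞, T+1)` since `G = 0` for `s ≤ 0`; Hörmander's hypoellipticity (`helper_hypoelliptic_noncompact`)
gives a smooth representative `v`, which solves the equation classically
(`helper_classicalOfVeryWeak_noncompact`), vanishes on `M × (−∞, −2)` (continuity) and on `M × [−3, 0]` by
energy uniqueness with cut-offs (`helper_energyVanishing`); then `w = W + v`.

References: F. Trèves, *Basic Linear Partial Differential Equations* (1975), §41, Thm. 40.1; L. Hörmander,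
Acta Math. 119 (1967); A. Grigor'yan, *Heat kernel and analysis on manifolds* (2009), Ch. 8.
-/

noncomputable section

set_option linter.dupNamespace false

open scoped Manifold ContDiff ENNReal NNReal Topology
open MeasureTheory Set Filter
open Literature.Geometry.Lorentzian Literature.Geometry.Riemannian
open Literature.Geometry.Lorentzian.PseudoRiemannianMetric (laplaceBeltrami_eq_dalembertian)

namespace Summit.SmoothPoincare4.SmoothPoincare4.Theorems.NoncompactShrinkerGapHeat

section Static

variable {n : ℕ} {M : Type*} [TopologicalSpace M] [T2Space M] [SecondCountableTopology M]
  [ChartedSpace (EuclideanSpace ℝ (Fin n)) M] [IsManifold (𝓡 n) ∞ M] [T3Space M] [MeasurableSpace M]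
  [BorelSpace M]
  {g : PseudoRiemannianMetric (𝓡 n) ∞ (EuclideanSpace ℝ (Fin n)) (TangentSpace (𝓡 n) : M → Type _)}
  [g.HasLeviCivita]

omit [T2Space M] [SecondCountableTopology M] [T3Space M] [MeasurableSpace M] [BorelSpace M] in
/-- The static heat adjoint `−∂ₛζ − Δ_g ζ(·, s) + Qζ` of a test function vanishes off its support. [folklore] -/
theorem staticHeatAdjoint_eq_zero_of_notMem_tsupport (Q : ℝ → M → ℝ) {ζ : M × ℝ → ℝ} {p : M × ℝ}
    (hp : p ∉ tsupport ζ) :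
    -(deriv (fun s ↦ ζ (p.1, s)) p.2) - g.laplaceBeltrami (fun x ↦ ζ (x, p.2)) p.1 + Q p.2 p.1 * ζ p = 0 := by
  have hev : ζ =ᶠ[𝓝 p] fun _ ↦ 0 := notMem_tsupport_iff_eventuallyEq.1 hp
  have h1 : (fun s ↦ ζ (p.1, s)) =ᶠ[𝓝 p.2] fun _ ↦ 0 := by
    have hc : Tendsto (fun s : ℝ ↦ (p.1, s)) (𝓝 p.2) (𝓝 p) :=
      (Continuous.prodMk_right p.1).tendsto p.2
    exact hev.comp_tendsto hc
  have h2 : (fun x ↦ ζ (x, p.2)) =ᶠ[𝓝 p.1] fun _ ↦ 0 := by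
    have hc : Tendsto (fun x : M ↦ (x, p.2)) (𝓝 p.1) (𝓝 p) :=
      (Continuous.prodMk_left p.2).tendsto p.1
    exact hev.comp_tendsto hc
  rw [h1.deriv_eq, deriv_const, laplaceBeltrami_eq_dalembertian,
    g.dalembertian_eq_zero_of_eventuallyEq_zero h2, image_eq_zero_of_notMem_tsupport hp]
  simp

/-- **The forced static problem on a complete manifold** (non-compact `exists_smooth_linearHeat_forcing`):
for `Q ≥ 1` smooth, `G` smooth with compact support in `M × ℝ` and `G = 0` for `s ≤ 0`, and Laplacian
cut-offs `η_k`, there is `v` smooth on `M × (−∞, b)` with `v = 0` for `s ≤ 0`,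
`∂ₛv = Δ_g v − Qv + G` on `M × (−∞, b)`, and `v ∈ L²(M × ℝ, dV ⊗ ds)`-a.e. equal to Lions' solution, in
particular `v² ∈ L¹(M × (0, b'))` for `b' < b`. [cite: Treves1975, §41, Thm. 40.1] -/
theorem exists_smooth_linearHeat_forcing_static (hg : g.IsRiemannian)
    {η : ℕ → M → ℝ} {C : ℝ} (hηs : ∀ k, ContMDiff (𝓡 n) 𝓘(ℝ, ℝ) ∞ (η k))
    (hηc : ∀ k, HasCompactSupport (η k)) (hη01 : ∀ k x, 0 ≤ η k x ∧ η k x ≤ 1)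
    (hηmono : ∀ k x, η k x ≤ η (k + 1) x) (hη1 : ∀ x, ∀ᶠ k in atTop, ∀ᶠ y in 𝓝 x, η k y = 1)
    (hηΔ : ∀ k x, |g.dalembertian (η k) x| ≤ C)
    {Q G : ℝ → M → ℝ} (hQ : ContMDiff ((𝓡 n).prod 𝓘(ℝ, ℝ)) 𝓘(ℝ, ℝ) ∞ (fun p : M × ℝ ↦ Q p.2 p.1))
    (hQ1 : ∀ s x, 1 ≤ Q s x)
    (hG : ContMDiff ((𝓡 n).prod 𝓘(ℝ, ℝ)) 𝓘(ℝ, ℝ) ∞ (fun p : M × ℝ ↦ G p.2 p.1))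
    (hGc : HasCompactSupport (fun p : M × ℝ ↦ G p.2 p.1)) (hG0 : ∀ s ≤ (0 : ℝ), ∀ x, G s x = 0)
    {b : ℝ} (hb : 0 < b) :
    ∃ v : M × ℝ → ℝ, ContMDiffOn ((𝓡 n).prod 𝓘(ℝ, ℝ)) 𝓘(ℝ, ℝ) ∞ v (univ ×ˢ Iio b) ∧
      (∀ x, ∀ s ≤ (0 : ℝ), v (x, s) = 0) ∧
      (∀ x, ∀ s < b, deriv (fun r ↦ v (x, r)) s =
        g.laplaceBeltrami (fun y ↦ v (y, s)) x - Q s x * v (x, s) + G s x) ∧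
      Integrable (fun p : M × ℝ ↦ v p ^ 2) ((g.riemVolume.prod (volume : Measure ℝ)).restrict
        (univ ×ˢ Ioo 0 b)) := by
  classical
  haveI : LocallyCompactSpace M := ChartedSpace.locallyCompactSpace (EuclideanSpace ℝ (Fin n)) M
  haveI := CarrilloNi2009_shrinkerLSI.isFiniteMeasureOnCompacts_riemVolume hg
  set μ₀ : Measure M := g.riemVolume with hμ₀
  haveI : μ₀.IsOpenPosMeasure := CutoffToolkit.isOpenPosMeasure_riemVolume hg
  haveI : (μ₀.prod (volume : Measure ℝ)).IsOpenPosMeasure := Measure.prod.instIsOpenPosMeasure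
  haveI : SigmaFinite μ₀ := CutoffToolkit.sigmaFinite_riemVolume hg
  have hab : (-2 : ℝ) < b := by linarith
  -- Lions' very weak solution on `M × (-2, b)`, extended by zero
  obtain ⟨u, hum, hu2, hu0, huweak⟩ := helper_veryWeakHeat_noncompact n M g hg Q G hQ hG hGc (-2) b hab
    (fun x s _ ↦ hQ1 s x)
  -- it is a very weak solution on `M × (-∞, b)` (the forcing vanishes for `s ≤ 0`)
  have huweak' : ∀ ζ : M × ℝ → ℝ, ContMDiff ((𝓡 n).prod 𝓘(ℝ, ℝ)) 𝓘(ℝ, ℝ) ∞ ζ → HasCompactSupport ζ →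
      tsupport ζ ⊆ univ ×ˢ Iio b →
      ∫ p, u p * (-(deriv (fun s ↦ ζ (p.1, s)) p.2) - g.laplaceBeltrami (fun x ↦ ζ (x, p.2)) p.1 +
          Q p.2 p.1 * ζ p) ∂μ₀.prod (volume : Measure ℝ) =
        ∫ p, G p.2 p.1 * ζ p ∂μ₀.prod (volume : Measure ℝ) := by
    intro ζ hζ hζc hζb
    rw [huweak ζ hζ hζc hζb]
    refine setIntegral_eq_integral_of_forall_compl_eq_zero fun p hp ↦ ?_
    by_cases hpb : p.2 < b
    · have hpa : p.2 ≤ -2 := by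
        by_contra h'
        exact hp ⟨mem_univ _, not_le.1 h', hpb⟩
      rw [hG0 p.2 (by linarith) p.1, zero_mul]
    · have hp' : p ∉ tsupport ζ := fun h' ↦ hpb (hζb h').2
      rw [image_eq_zero_of_notMem_tsupport hp', mul_zero]
  -- interior regularity on the open time set `(-∞, b)`
  have hu1 : LocallyIntegrableOn u (univ ×ˢ Iio b) (μ₀.prod (volume : Measure ℝ)) :=
    (hu2.locallyIntegrable (by norm_num)).locallyIntegrableOn _
  obtain ⟨v, hv, hae⟩ := helper_hypoelliptic_noncompact n M g hg Q G hQ hG (Iio b) u isOpen_Iio hum hu1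
    huweak'
  -- the weak identity for the smooth representative
  have hvweak : ∀ ζ : M × ℝ → ℝ, ContMDiff ((𝓡 n).prod 𝓘(ℝ, ℝ)) 𝓘(ℝ, ℝ) ∞ ζ → HasCompactSupport ζ →
      tsupport ζ ⊆ univ ×ˢ Iio b →
      ∫ p, v p * (-(deriv (fun s ↦ ζ (p.1, s)) p.2) - g.laplaceBeltrami (fun x ↦ ζ (x, p.2)) p.1 +
          Q p.2 p.1 * ζ p) ∂μ₀.prod (volume : Measure ℝ) =
        ∫ p, G p.2 p.1 * ζ p ∂μ₀.prod (volume : Measure ℝ) := by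
    intro ζ hζ hζc hζb
    rw [← huweak' ζ hζ hζc hζb]
    refine integral_congr_ae ?_
    filter_upwards [hae] with p hp
    by_cases hpz : p ∈ tsupport ζ
    · rw [hp (hζb hpz)]
    · simp only [staticHeatAdjoint_eq_zero_of_notMem_tsupport Q hpz, mul_zero]
  -- the classical equation on `M × (-∞, b)`
  have hclass : ∀ x, ∀ s < b, deriv (fun r ↦ v (x, r)) s =
      g.laplaceBeltrami (fun y ↦ v (y, s)) x - Q s x * v (x, s) + G s x := by
    intro x s hs
    have h := helper_classicalOfVeryWeak_noncompact n M g hg Q G hQ hG (Iio b) v isOpen_Iio hv hvweak (x, s)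
      ⟨mem_univ _, hs⟩
    simp only at h
    linarith
  -- `v = 0` on `M × (-∞, -2)`, where `u = 0`
  have hv0 : ∀ x, ∀ s < (-2 : ℝ), v (x, s) = 0 := by
    have hO : IsOpen ((univ : Set M) ×ˢ Iio (-2 : ℝ)) := isOpen_univ.prod isOpen_Iio
    have hsub : (univ : Set M) ×ˢ Iio (-2 : ℝ) ⊆ univ ×ˢ Iio b :=
      Set.prod_mono le_rfl (Iio_subset_Iio hab.le)
    have heq : EqOn v 0 ((univ : Set M) ×ˢ Iio (-2 : ℝ)) := by
      refine Measure.eqOn_open_of_ae_eq (μ := μ₀.prod (volume : Measure ℝ)) ?_ hO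
        (hv.mono hsub).continuousOn continuousOn_const
      rw [Filter.EventuallyEq, ae_restrict_iff' hO.measurableSet]
      filter_upwards [hae] with p hp hpO
      rw [← hp (hsub hpO), Pi.zero_apply]
      exact hu0 p fun h' ↦ lt_irrefl _ (h'.1.trans hpO.2)
    intro x s hs
    exact heq ⟨mem_univ _, hs⟩
  -- `v² ∈ L¹` of every strip inside `(-∞, b)` (`v = u` a.e., `u ∈ L²`)
  have hu2sq : Integrable (fun p : M × ℝ ↦ u p ^ 2) (μ₀.prod (volume : Measure ℝ)) := by
    have := hu2.integrable_norm_rpow two_ne_zero ENNReal.ofNat_ne_top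
    refine this.congr (Eventually.of_forall fun p ↦ ?_)
    simp [Real.norm_eq_abs, sq_abs]
  have hv2 : ∀ a' b' : ℝ, b' ≤ b → Integrable (fun p : M × ℝ ↦ v p ^ 2)
      ((μ₀.prod (volume : Measure ℝ)).restrict (univ ×ˢ Ioo a' b')) := by
    intro a' b' hb'
    refine (hu2sq.restrict (s := univ ×ˢ Ioo a' b')).congr ?_
    rw [Filter.EventuallyEq, ae_restrict_iff' (MeasurableSet.univ.prod measurableSet_Ioo)]
    filter_upwards [hae] with p hp hpS
    rw [hp ⟨mem_univ _, lt_of_lt_of_le hpS.2.2 hb'⟩]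
  -- `v = 0` on `M × [-3, 0]` by energy uniqueness for the homogeneous equation
  have hv00 : ∀ s ∈ Icc (-3 : ℝ) 0, ∀ x, v (x, s) = 0 := by
    refine helper_energyVanishing n M g hg η C hηs hηc hη01 hηmono hη1 hηΔ Q (-3) 0 (Iio b) v (by norm_num)
      isOpen_Iio (fun s hs ↦ lt_of_le_of_lt hs.2 hb) (fun s _ x ↦ zero_le_one.trans (hQ1 s x)) hv ?_ ?_ ?_
    · intro s hs x
      rw [hclass x s (lt_of_le_of_lt hs.2 hb), hG0 s hs.2 x, add_zero, laplaceBeltrami_eq_dalembertian]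
    · intro x
      exact hv0 x (-3) (by norm_num)
    · exact hv2 (-3) 0 hb.le
  refine ⟨v, hv, fun x s hs ↦ ?_, hclass, hv2 0 b le_rfl⟩
  rcases lt_or_ge s (-2) with hs' | hs'
  · exact hv0 x s hs'
  · exact hv00 s ⟨by linarith, hs⟩ x

end Static

/-- **Helper `helper_linearHeat_noncompact`** (line `collapsed-ends-usc`, v13; see the module docstring): the
linear heat Cauchy problem `∂ₛw = Δ_g w − Qw`, `w(0) = W(0)`, for flat-corrector data `(W, G, K)` on a complete
manifold with Laplacian cut-offs — a solution smooth on `M × (−∞, T+1)` and square integrable on `M × (0, T)`.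
[cite: Treves1975, §41, Thm. 40.1] -/
theorem helper_linearHeat_noncompact : ∀ (n : ℕ) (M : Type*) [TopologicalSpace M] [T2Space M] [SecondCountableTopology M] [ChartedSpace (EuclideanSpace ℝ (Fin n)) M] [IsManifold (𝓡 n) ∞ M] [T3Space M] [MeasurableSpace M] [BorelSpace M] (g : PseudoRiemannianMetric (𝓡 n) ∞ (EuclideanSpace ℝ (Fin n)) (TangentSpace (𝓡 n) : M → Type _)) [g.HasLeviCivita], g.IsRiemannian → ∀ (η : ℕ → M → ℝ) (C : ℝ), (∀ k, ContMDiff (𝓡 n) 𝓘(ℝ, ℝ) ∞ (η k)) → (∀ k, HasCompactSupport (η k)) → (∀ k x, 0 ≤ η k x ∧ η k x ≤ 1) → (∀ k x, η k x ≤ η (k + 1) x) → (∀ x, ∀ᶠ k in atTop, ∀ᶠ y in 𝓝 x, η k y = 1) → (∀ k x, |g.dalembertian (η k) x| ≤ C) → ∀ (Q : ℝ → M → ℝ), ContMDiff ((𝓡 n).prod 𝓘(ℝ, ℝ)) 𝓘(ℝ, ℝ) ∞ (fun p : M × ℝ ↦ Q p.2 p.1) → (∀ s x, 1 ≤ Q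 s x) → ∀ (W G : ℝ → M → ℝ) (K : Set M), IsCompact K → ContMDiff ((𝓡 n).prod 𝓘(ℝ, ℝ)) 𝓘(ℝ, ℝ) ∞ (fun p : M × ℝ ↦ W p.2 p.1) → ContMDiff ((𝓡 n).prod 𝓘(ℝ, ℝ)) 𝓘(ℝ, ℝ) ∞ (fun p : M × ℝ ↦ G p.2 p.1) → (∀ s x, x ∉ K → W s x = 0) → (∀ s x, x ∉ K → G s x = 0) → (∀ s, 1 ≤ s → ∀ x, W s x = 0 ∧ G s x = 0) → (∀ s ≤ 0, ∀ x, G s x = 0) → (∀ s, 0 ≤ s → ∀ x, G s x = -(deriv (fun r ↦ W r x) s - (g.laplaceBeltrami (W s) x - Q s x * W s x))) → ∀ T : ℝ, 0 < T → ∃ (O : Set ℝ) (w : ℝ → M → ℝ), IsOpen O ∧ Icc 0 T ⊆ O ∧ ContMDiffOn ((𝓡 n).prod 𝓘(ℝ, ℝ)) 𝓘(ℝ, ℝ) ∞ (fun p : M × ℝ ↦ w p.2 p.1) (univ ×ˢ O) ∧ (∀ x, w 0 x = W 0 x) ∧ (∀ s ∈ Icc 0 T, ∀ x, deriv (fun r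 ↦ w r x) s = g.dalembertian (w s) x - Q s x * w s x) ∧ Integrable (fun p : M × ℝ ↦ w p.2 p.1 ^ 2) ((g.riemVolume.prod (volume : Measure ℝ)).restrict (univ ×ˢ Ioo 0 T)) := by
  intro n M _ _ _ _ _ _ _ _ g _ hg η C hηs hηc hη01 hηmono hη1 hηΔ Q hQ hQ1 W G K hK hW hG hWK hGK hWG1 hG0
    hGW T hT
  classical
  haveI : LocallyCompactSpace M := ChartedSpace.locallyCompactSpace (EuclideanSpace ℝ (Fin n)) M
  haveI := CarrilloNi2009_shrinkerLSI.isFiniteMeasureOnCompacts_riemVolume hg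
  haveI : SigmaFinite g.riemVolume := CutoffToolkit.sigmaFinite_riemVolume hg
  -- `G` has compact support in `K × [0, 1]`
  have hGc : HasCompactSupport (fun p : M × ℝ ↦ G p.2 p.1) := by
    refine HasCompactSupport.intro (hK.prod (isCompact_Icc (a := (0 : ℝ)) (b := 1))) ?_
    rintro ⟨x, s⟩ hp
    simp only [mem_prod, mem_Icc, not_and_or, not_le] at hp
    rcases hp with hx | hs | hs
    · exact hGK s x hx
    · exact hG0 s hs.le x
    · exact (hWG1 s hs.le x).2
  set b : ℝ := T + 1 with hbdef
  have hb : 0 < b := by rw [hbdef]; linarith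
  obtain ⟨v, hv, hv0, hveq, hvL2⟩ := exists_smooth_linearHeat_forcing_static hg hηs hηc hη01 hηmono hη1
    hηΔ hQ hQ1 hG hGc hG0 hb
  -- the solution `w = W + v`
  set w : ℝ → M → ℝ := fun s x ↦ W s x + v (x, s) with hwdef
  have hws : ContMDiffOn ((𝓡 n).prod 𝓘(ℝ, ℝ)) 𝓘(ℝ, ℝ) ∞ (fun p : M × ℝ ↦ w p.2 p.1) (univ ×ˢ Iio b) :=
    hW.contMDiffOn.add hv
  refine ⟨Iio b, w, isOpen_Iio, fun s hs ↦ by simp only [mem_Iio, hbdef]; linarith [hs.2], hws, fun x ↦ ?_,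
    fun s hs x ↦ ?_, ?_⟩
  · simp [hwdef, hv0 x 0 le_rfl]
  · -- the equation on `[0, T]`
    have hsb : s < b := by rw [hbdef]; linarith [hs.2]
    have hdW : HasDerivAt (fun r ↦ W r x) (deriv (fun r ↦ W r x) s) s :=
      ((contDiff_time_slice hW x).differentiable (by simp)).differentiableAt.hasDerivAt
    have hdv : HasDerivAt (fun r ↦ v (x, r)) (deriv (fun r ↦ v (x, r)) s) s :=
      hasDerivAt_slice_of_contMDiffOn isOpen_Iio hv x hsb
    have hd : deriv (fun r ↦ w r x) s = deriv (fun r ↦ W r x) s + deriv (fun r ↦ v (x, r)) s :=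
      (hdW.add hdv).deriv
    have h2 : (2 : ℕ∞ω) ≤ (∞ : ℕ∞ω) := by norm_cast
    have hWs2 : ContMDiffAt (𝓡 n) 𝓘(ℝ, ℝ) 2 (W s) x :=
      ((contMDiff_space_slice hW s).of_le h2).contMDiffAt
    have hvs2 : ContMDiffAt (𝓡 n) 𝓘(ℝ, ℝ) 2 (fun y ↦ v (y, s)) x := by
      have hO : IsOpen ((univ : Set M) ×ˢ Iio b) := isOpen_univ.prod isOpen_Iio
      have h1 : ContMDiffOn (𝓡 n) 𝓘(ℝ, ℝ) ∞ (fun y ↦ v (y, s)) univ := fun y _ ↦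
        (hv.comp_contMDiff (f := fun y : M ↦ ((y, s) : M × ℝ)) (contMDiff_id.prodMk contMDiff_const)
          (fun y ↦ ⟨mem_univ _, hsb⟩)).contMDiffAt.contMDiffWithinAt
      exact ((contMDiffOn_univ.1 h1).of_le h2).contMDiffAt
    have hΔ : g.dalembertian (w s) x = g.dalembertian (W s) x + g.dalembertian (fun y ↦ v (y, s)) x := by
      have := g.dalembertian_add_of_contMDiffAt hWs2 hvs2
      simpa [hwdef, Pi.add_def] using this
    have hGW' := hGW s hs.1 x
    have hveq' := hveq x s hsb
    rw [laplaceBeltrami_eq_dalembertian] at hGW' hveq'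
    simp only [hwdef]
    rw [hd, hΔ]
    linarith
  · -- `w² ∈ L¹(M × (0, T))`: `W` is bounded with compact spatial support, `v ∈ L²`
    have hmeasS : MeasurableSet ((univ : Set M) ×ˢ Ioo (0 : ℝ) T) := MeasurableSet.univ.prod measurableSet_Ioo
    have hvT : Integrable (fun p : M × ℝ ↦ v p ^ 2)
        ((g.riemVolume.prod (volume : Measure ℝ)).restrict (univ ×ˢ Ioo 0 T)) := by
      refine hvL2.mono_measure (Measure.restrict_mono (Set.prod_mono le_rfl (Ioo_subset_Ioo le_rfl ?_)) le_rfl)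
      rw [hbdef]; linarith
    obtain ⟨B, hB⟩ := (hK.prod (isCompact_Icc (a := (0 : ℝ)) (b := T))).exists_bound_of_continuousOn
      (f := fun p : M × ℝ ↦ W p.2 p.1) hW.continuous.continuousOn
    have hWbd : ∀ p ∈ (univ : Set M) ×ˢ Ioo (0 : ℝ) T,
        ‖W p.2 p.1‖ ≤ (K ×ˢ (univ : Set ℝ)).indicator (fun _ ↦ max B 0) p := by
      rintro ⟨x, s⟩ ⟨-, hs⟩
      by_cases hx : x ∈ K
      · rw [indicator_of_mem (show ((x, s) : M × ℝ) ∈ K ×ˢ (univ : Set ℝ) from ⟨hx, mem_univ _⟩)]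
        exact (hB (x, s) ⟨hx, Ioo_subset_Icc_self hs⟩).trans (le_max_left _ _)
      · rw [indicator_of_notMem (show ((x, s) : M × ℝ) ∉ K ×ˢ (univ : Set ℝ) from fun h ↦ hx h.1)]
        simp [hWK s x hx]
    set ν : Measure (M × ℝ) := (g.riemVolume.prod (volume : Measure ℝ)).restrict (univ ×ˢ Ioo 0 T) with hν
    have hKfin : ν (K ×ˢ (univ : Set ℝ)) ≠ (⊤ : ℝ≥0∞) := by
      rw [hν, Measure.restrict_apply (hK.measurableSet.prod MeasurableSet.univ)]
      have h1 : K ×ˢ (univ : Set ℝ) ∩ (univ : Set M) ×ˢ Ioo (0 : ℝ) T = K ×ˢ Ioo (0 : ℝ) T := by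
        ext ⟨x, s⟩; simp [mem_prod]
      rw [h1, Measure.prod_prod]
      exact (ENNReal.mul_lt_top (hK.measure_lt_top) measure_Ioo_lt_top).ne
    have hdom : Integrable (fun p : M × ℝ ↦ ((K ×ˢ (univ : Set ℝ)).indicator (fun _ ↦ max B 0) p) ^ 2 +
        v p ^ 2 + 2 * (((K ×ˢ (univ : Set ℝ)).indicator (fun _ ↦ max B 0) p) * |v p|)) ν := by
      have hI : Integrable (fun p : M × ℝ ↦ (K ×ˢ (univ : Set ℝ)).indicator (fun _ ↦ max B 0) p) ν :=
        (integrableOn_const (C := max B 0) hKfin).integrable_indicator (hK.measurableSet.prod MeasurableSet.univ)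
      have hI2 : Integrable (fun p : M × ℝ ↦ ((K ×ˢ (univ : Set ℝ)).indicator (fun _ ↦ max B 0) p) ^ 2) ν := by
        have : (fun p : M × ℝ ↦ ((K ×ˢ (univ : Set ℝ)).indicator (fun _ ↦ max B 0) p) ^ 2) =
            (K ×ˢ (univ : Set ℝ)).indicator (fun _ ↦ (max B 0) ^ 2) := by
          funext p
          by_cases hp : p ∈ K ×ˢ (univ : Set ℝ)
          · simp [indicator_of_mem hp]
          · simp [indicator_of_notMem hp]
        rw [this]
        exact (integrableOn_const (C := (max B 0) ^ 2) hKfin).integrable_indicator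
          (hK.measurableSet.prod MeasurableSet.univ)
      -- `indicator * |v|` is dominated by `indicator² + v²` up to the factor 1/2; use `2ab ≤ a² + b²`
      have hIv : Integrable (fun p : M × ℝ ↦ ((K ×ˢ (univ : Set ℝ)).indicator (fun _ ↦ max B 0) p) * |v p|) ν := by
        refine (hI2.add hvT).mono' ?_ (Eventually.of_forall fun p ↦ ?_)
        · refine (hI.aestronglyMeasurable.mul ?_)
          have hvc : ContinuousOn v ((univ : Set M) ×ˢ Ioo (0 : ℝ) T) :=
            hv.continuousOn.mono (Set.prod_mono le_rfl fun s hs ↦ by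
              simp only [mem_Iio, hbdef]; linarith [hs.2])
          exact (hvc.aestronglyMeasurable hmeasS).norm.congr (Eventually.of_forall fun p ↦ by
            simp [Real.norm_eq_abs])
        · show ‖(K ×ˢ (univ : Set ℝ)).indicator (fun _ ↦ max B 0) p * |v p|‖ ≤
            ((K ×ˢ (univ : Set ℝ)).indicator (fun _ ↦ max B 0) p) ^ 2 + v p ^ 2
          rw [Real.norm_eq_abs, abs_mul, abs_abs]
          have ha : 0 ≤ (K ×ˢ (univ : Set ℝ)).indicator (fun _ ↦ max B 0) p := by
            by_cases hp : p ∈ K ×ˢ (univ : Set ℝ)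
            · simp [indicator_of_mem hp]
            · simp [indicator_of_notMem hp]
          rw [abs_of_nonneg ha]
          nlinarith [sq_nonneg ((K ×ˢ (univ : Set ℝ)).indicator (fun _ ↦ max B 0) p - |v p|), sq_abs (v p)]
      exact (hI2.add hvT).add (hIv.const_mul 2)
    refine hdom.mono' ?_ ?_
    · have hwc : ContinuousOn (fun p : M × ℝ ↦ w p.2 p.1 ^ 2) ((univ : Set M) ×ˢ Ioo (0 : ℝ) T) :=
        (hws.continuousOn.mono (Set.prod_mono le_rfl fun s hs ↦ by
          simp only [mem_Iio, hbdef]; linarith [hs.2])).pow 2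
      exact hwc.aestronglyMeasurable hmeasS
    · rw [hν, ae_restrict_iff' hmeasS]
      refine Eventually.of_forall fun p hp ↦ ?_
      have h1 := hWbd p hp
      rw [Real.norm_eq_abs] at h1
      rw [Real.norm_eq_abs, abs_pow, hwdef]
      simp only
      have h2 : |W p.2 p.1 + v (p.1, p.2)| ≤ |W p.2 p.1| + |v p| := by
        simpa using abs_add_le (W p.2 p.1) (v (p.1, p.2))
      have h3 : 0 ≤ |W p.2 p.1| := abs_nonneg _
      have h4 : 0 ≤ |v p| := abs_nonneg _
      calc |W p.2 p.1 + v (p.1, p.2)| ^ 2 ≤ (|W p.2 p.1| + |v p|) ^ 2 :=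
            pow_le_pow_left₀ (abs_nonneg _) h2 2
        _ ≤ ((K ×ˢ (univ : Set ℝ)).indicator (fun _ ↦ max B 0) p + |v p|) ^ 2 := by
            apply pow_le_pow_left₀ (by positivity)
            linarith
        _ = ((K ×ˢ (univ : Set ℝ)).indicator (fun _ ↦ max B 0) p) ^ 2 + v p ^ 2 +
              2 * (((K ×ˢ (univ : Set ℝ)).indicator (fun _ ↦ max B 0) p) * |v p|) := by
            rw [add_sq, sq_abs]; ring

end Summit.SmoothPoincare4.SmoothPoincare4.Theorems.NoncompactShrinkerGapHeat

end
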